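/-
Copyright (c) 2026 the pub-hodgecm-mathlib formalisation cell (harness21).  Prover seat hodgecm-mathlib-K2E3-p11 (g5), Track B «K2-LIT» ∕ h413
(`stmt-HodgeConjecture-24833`), line `K2_E3_EllipticInputs`, unit U12 §L, Richardson road for (LBGL-ge3) at `N = 3` (road owner K2E3-p11), brick (F-E) =
(LBGL-3E) «THE (2,1)-PARABOLIC SLICE DENSITY OF 𝔤𝔩₃(F)», HEAD FILE H″7 = THE LEAF (socket (LBGL-3E) `sig_K2E3GL3ParabolicSliceDensity` of U12, ED. 16).  2026-09-04.
-/
import Summits.HodgeConjecture.HodgeConjecture.Theorems.K2E3GL3ParabolicSliceDensityAE      -- ★ H″6 (this seat): the slice functional IS `w·μ𝔤`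
import Summits.HodgeConjecture.HodgeConjecture.Theorems.K2E3GL3CharpolyDiscNull             -- ★ H″4 (K2E3-p17 (g6)): the parabolic discriminant locus is null
import Summits.HodgeConjecture.HodgeConjecture.Theorems.K2E3CubicDiscDerivativeBound        -- ★ W-BOUND (K2E3-p03 (g4)): `√‖disc χ‖ ≤ B·‖χ′(a)‖` on compacta
import Summits.HodgeConjecture.HodgeConjecture.Theorems.K2E3GL3BorelSliceDensity            -- ★ twin leaf (K2E3-p17 (g6)): `exists_forall_mem_primePowBall_of_isCompact`
import Literature.NumberTheory.Rogawski1990.LocalTransferFundamentalLemma                   -- ★ `IsLocSmooth`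
import HarnessLib

/-!
# K2_E3 road (h413), §L (LBGL-3E): THE `(2,1)`-PARABOLIC SLICE DENSITY OF `𝔤𝔩₃(F)` — `∫_K ∫_{𝔭} f(Ad(k) p) dp dk = ∫ f · W_𝔭 dμ𝔤` with
# `W_𝔭(X) = c · 1[disc χ_X ≠ 0] · Σ_{a ∈ F, χ_X(a) = 0} ‖χ_X′(a)‖_F⁻¹ ∈ L¹_loc`, locally constant on the regular semisimple set, `‖disc‖^{1∕2} W_𝔭` locally bounded

Cell `pub/hodgecm-mathlib` (D-0151), Track B, seat K2E3-p11 (g5) = road owner of (F-E) (ROAD v2, `K2/STATUS.md` 2026-09-04 05:41:53Z; head = socket (LBGL-3E)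
`sig_K2E3GL3ParabolicSliceDensity` of `Lines/K2_E3_EllipticInputsSigs_U12Characters.lean` ED. 16, tie BY APPLICATION `exists_parabolicSliceDensity μ𝔤 κ dx`).
`--supports stmt-HodgeConjecture-24833 --as helper`; THEOREMS ONLY (no definition ∕ instance ∕ notation ∕ named fact ∕ `sorry`); never imports `Cruxes/…/Lines`.
COUNT-NEUTRAL until the planner ties the socket.  NO `[CharZero F]`, NO `ψ`; the local integrability of `W_𝔭` FALLS OUT of the local finiteness of the left side.

THE RESULT (**`exists_parabolicSliceDensity`**) — Harish-Chandra's descent to the maximal parabolic `𝔭 = 𝔪 ⊕ 𝔫`, `𝔪 = 𝔤𝔩₂ ⊕ 𝔤𝔩₁`, read through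
`K × 𝔭 → 𝔤𝔩₃`, `(k, p) ↦ Ad(k)p`: the fibre over a regular semisimple `X` is the set of `F`-rational roots `a` of `χ_X` (the `𝔤𝔩₁`-eigenvalue of the Levi part),
each counted with the Jacobian `‖χ_X′(a)‖_F⁻¹ = ‖det(ad(X)|𝔫)‖⁻¹`; so `W_𝔭(X) = c · Σ_{a} ‖χ_X′(a)‖⁻¹` on `{disc χ ≠ 0}` (elliptic classes: `W_𝔭 = 0`; classes with
one rational root: one term; split classes: three terms).  ASSEMBLY: ★ H″6 `K2E3GL3ParabolicSliceDensityAE` (the `ℝ≥0∞` identity `∫⁻_K∫⁻_𝔭 h∘Ad = ∫⁻ h·w dμ𝔤`,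
itself glued from the 𝔭-centred one-unipotent charts ★ E″∕G″∕H″1–3 and the local densities ★ H″6b over Lindelöf) + ★ H″4 (the singular set of the slice is
null) + local finiteness (a compact set of `𝔤𝔩₃` is swept by a bounded box of `𝔭` uniformly over `K`) + the Bochner template of the twin ★ `K2E3GL3BorelSliceDensity`
+ ★ H″6b `setOf_discr_ne_zero_and_sum_eq_mem_nhds` (local constancy) + ★ W-BOUND `K2E3CubicDiscDerivativeBound` (`√‖disc‖·‖χ′(a)‖⁻¹ ≤ B` on compacta, `≤ 3` roots).
[HarishChandra1999AdmissibleDistributions, Thm. 4.4 p. 11, §7 (Lemma 7.8, Lemma 7.9)] [Howe1974, §2 Prop. 3] [HarishChandra1970, Part V §4 Lemma 22]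
HONEST LABEL: HC_CM is proved only modulo the 7 printed citations (2 remaining named inputs: hLiu418 = stmt-HodgeConjecture-24832, h413 = stmt-HodgeConjecture-24833)
until rung 0 closes; (LBGL-3E) is ONE of the two leaves of (LBGL-ge3) at `N = 3` (the other, (LBGL-3J), is ★ `K2E3GL3BorelSliceDensity`); count-neutral helper until tied.

## References
* [HarishChandra1999AdmissibleDistributions] Harish-Chandra (notes by S. DeBacker and P. J. Sally, Jr.), *Admissible Invariant Distributions on Reductive p-adic
  Groups*, University Lecture Series 16, AMS (1999), Thm. 4.4, §7.
* [Howe1974] R. Howe, *The Fourier transform and germs of characters (case of GL_n over a p-adic field)*, Math. Ann. 208 (1974), §2 Prop. 3.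
* [HarishChandra1970] Harish-Chandra (van Dijk), *Harmonic Analysis on Reductive p-adic Groups*, LNM 162 (1970), Part V §4.
-/

set_option autoImplicit false
set_option linter.dupNamespace false

noncomputable section

open MeasureTheory Measure Filter Topology Set Matrix ValuativeRel Polynomial
open scoped MatrixGroups NNReal ENNReal Valued
open Literature.NumberTheory.Rogawski1990
open Literature.NumberTheory.Automorphic Literature.NumberTheory.Automorphic.LocalFieldHaar
open Literature.NumberTheory.GaloisRepresentations Literature.NumberTheory.GaloisRepresentations.IsNonarchimedeanLocalField

namespace Summit.HodgeConjecture.HodgeConjecture.Cruxes.H413.K2E3GL3ParabolicSliceDensity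

/-! ## §1  `ℝ≥0`-valued multiset sums coerce to `ℝ≥0∞` termwise -/

/-- `↑((t.map g).sum) = (t.map (↑ ∘ g)).sum` for the coercion `ℝ≥0 → ℝ≥0∞` (bookkeeping between the `ℝ≥0∞` density of ★ H″6 and its `ℝ≥0` avatar). -/
theorem coe_multiset_sum_map {ι : Type*} (t : Multiset ι) (g : ι → ℝ≥0) :
    ((((t.map g).sum : ℝ≥0)) : ℝ≥0∞) = (t.map fun i => ((g i : ℝ≥0) : ℝ≥0∞)).sum := by
  induction t using Multiset.induction_on with
  | empty => simp
  | cons a t ih => rw [Multiset.map_cons, Multiset.map_cons, Multiset.sum_cons, Multiset.sum_cons, ENNReal.coe_add, ih]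

/-! ## §2  The head -/

section Head

variable {F : Type*} [Field F] [ValuativeRel F] [TopologicalSpace F] [IsNonarchimedeanLocalField F]
  [MeasurableSpace F] [BorelSpace F] [MeasurableSpace (GL (Fin 3) F)] [BorelSpace (GL (Fin 3) F)]
  [MeasurableSpace (Matrix (Fin 3) (Fin 3) F)] [BorelSpace (Matrix (Fin 3) (Fin 3) F)]

/-- **(LBGL-3E) THE `(2,1)`-PARABOLIC SLICE DENSITY OF `𝔤𝔩₃(F)`** (see the module docstring): there is `W : 𝔤𝔩₃(F) → ℂ` — namely
`W(X) = c · 1[disc χ_X ≠ 0] · Σ_{a ∈ F, χ_X(a) = 0} ‖χ_X′(a)‖_F⁻¹`, `c > 0` — locally integrable, with `∫_K ∫_{F⁷} f(k P(r) k⁻¹) dr dk = ∫ f W dμ𝔤` for every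
`f ∈ C_c^∞(𝔤𝔩₃(F))` (`P(r) = [[r₀,r₁,r₂],[r₃,r₄,r₅],[0,0,r₆]]`), locally constant on `{disc χ ∈ Fˣ}`, and `√‖disc χ_X‖ · ‖W(X)‖` bounded on compacta.
[cite: HarishChandra1999AdmissibleDistributions, Thm. 4.4 p. 11, Lemma 7.8, Lemma 7.9] [cite: Howe1974, §2 Prop. 3] [cite: HarishChandra1970, Part V §4 Lemma 22] -/
theorem exists_parabolicSliceDensity
    (μ𝔤 : Measure (Matrix (Fin 3) (Fin 3) F)) [μ𝔤.IsAddHaarMeasure]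
    (κ : Measure ↥(glInt 3 F)) [IsHaarMeasure κ] (dx : Measure F) [dx.IsAddHaarMeasure] :
    ∃ W : Matrix (Fin 3) (Fin 3) F → ℂ, LocallyIntegrable W μ𝔤 ∧
      (∀ f : Matrix (Fin 3) (Fin 3) F → ℂ, IsLocSmooth f →
        ∫ k : ↥(glInt 3 F), ∫ r : Fin 7 → F,
            f (((k : GL (Fin 3) F) : Matrix (Fin 3) (Fin 3) F) * !![r 0, r 1, r 2; r 3, r 4, r 5; 0, 0, r 6] *
              ((((k : GL (Fin 3) F))⁻¹ : GL (Fin 3) F) : Matrix (Fin 3) (Fin 3) F)) ∂(Measure.pi fun _ : Fin 7 => dx) ∂κ = ∫ X, f X * W X ∂μ𝔤) ∧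
      (∀ X : Matrix (Fin 3) (Fin 3) F, IsUnit X.charpoly.discr → ∀ᶠ Y in 𝓝 X, W Y = W X) ∧
      (∀ C : Set (Matrix (Fin 3) (Fin 3) F), IsCompact C → ∃ B : ℝ, ∀ X ∈ C,
          ((NNReal.sqrt (normAbs F X.charpoly.discr) : ℝ≥0) : ℝ) * ‖W X‖ ≤ B) := by
  classical
  haveI : T2Space F := (isLocalField F).toT2Space
  haveI : LocallyCompactSpace F := (isLocalField F).toLocallyCompactSpace
  haveI : SecondCountableTopology F := secondCountableTopology_localField F
  haveI : IsTopologicalRing F := inferInstance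
  haveI : SecondCountableTopology (Matrix (Fin 3) (Fin 3) F) := inferInstanceAs (SecondCountableTopology (Fin 3 → Fin 3 → F))
  haveI : LocallyCompactSpace (Matrix (Fin 3) (Fin 3) F) := Pi.locallyCompactSpace_of_finite
  haveI : CompactSpace ↥(glInt 3 F) := isCompact_iff_compactSpace.1 (isCompact_glInt (n := 3) (F := F))
  haveI : IsFiniteMeasure κ := CompactSpace.isFiniteMeasure
  -- ★ H″6 over ★ H″4: the `ℝ≥0∞` identity with the `ℝ≥0∞` density
  obtain ⟨C, hC0, hCt, hId⟩ := K2E3GL3ParabolicSliceDensityAE.exists_lintegral_parabolicSlice_eq_lintegral_mul_density (F := F) κ dx μ𝔤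
    (K2E3GL3CharpolyDiscNull.pi_setOf_discr_charpoly_parabolic_eq_zero (F := F) dx)
  -- the `ℝ≥0` avatar `w` of the density and `W = w : ℂ`
  set c : ℝ≥0 := C.toNNReal with hc
  have hcC : (c : ℝ≥0∞) = C := ENNReal.coe_toNNReal hCt
  set s : Matrix (Fin 3) (Fin 3) F → ℝ≥0 := fun X => (X.charpoly.roots.map fun a => (normAbs F (X.charpoly.derivative.eval a))⁻¹).sum with hs
  have hscoe : ∀ X : Matrix (Fin 3) (Fin 3) F, ((s X : ℝ≥0) : ℝ≥0∞) =
      (X.charpoly.roots.map fun a => (((normAbs F (X.charpoly.derivative.eval a))⁻¹ : ℝ≥0) : ℝ≥0∞)).sum := fun X => coe_multiset_sum_map _ _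
  set w : Matrix (Fin 3) (Fin 3) F → ℝ≥0 := ({X : Matrix (Fin 3) (Fin 3) F | X.charpoly.discr ≠ 0}).indicator fun X => c * s X with hw
  have hwE : ∀ X : Matrix (Fin 3) (Fin 3) F, ((w X : ℝ≥0) : ℝ≥0∞) = ({X : Matrix (Fin 3) (Fin 3) F | X.charpoly.discr ≠ 0}).indicator
      (fun X => C * (X.charpoly.roots.map fun a => (((normAbs F (X.charpoly.derivative.eval a))⁻¹ : ℝ≥0) : ℝ≥0∞)).sum) X := by
    intro X
    by_cases hX : X ∈ {X : Matrix (Fin 3) (Fin 3) F | X.charpoly.discr ≠ 0}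
    · rw [hw, Set.indicator_of_mem hX, Set.indicator_of_mem hX, ENNReal.coe_mul, hcC, hscoe]
    · rw [hw, Set.indicator_of_notMem hX, Set.indicator_of_notMem hX, ENNReal.coe_zero]
  have hwm : Measurable w := by
    have h := (K2E3GL3ParabolicSliceDensityAE.measurable_density (F := F) C).ennreal_toNNReal
    have he : (fun X : Matrix (Fin 3) (Fin 3) F => (({X : Matrix (Fin 3) (Fin 3) F | X.charpoly.discr ≠ 0}).indicator
        (fun X => C * (X.charpoly.roots.map fun a => (((normAbs F (X.charpoly.derivative.eval a))⁻¹ : ℝ≥0) : ℝ≥0∞)).sum) X).toNNReal) = w := by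
      funext X
      rw [← hwE X, ENNReal.toNNReal_coe]
    rw [he] at h
    exact h
  set W : Matrix (Fin 3) (Fin 3) F → ℂ := fun X => (((w X : ℝ≥0) : ℝ) : ℂ) with hW
  have hWm : Measurable W := Complex.measurable_ofReal.comp (measurable_coe_nnreal_real.comp hwm)
  have hnormW : ∀ X, ‖W X‖ = ((w X : ℝ≥0) : ℝ) := fun X => by
    rw [hW]; simp only [Complex.norm_real, Real.norm_eq_abs, abs_of_nonneg (NNReal.coe_nonneg _)]
  -- (1) the `ℝ≥0∞` identity against `μ𝔤`, density on the left
  have hL : ∀ g : Matrix (Fin 3) (Fin 3) F → ℝ≥0∞, Measurable g →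
      ∫⁻ k : ↥(glInt 3 F), ∫⁻ r : Fin 7 → F, g (((k : GL (Fin 3) F) : Matrix (Fin 3) (Fin 3) F) * !![r 0, r 1, r 2; r 3, r 4, r 5; 0, 0, r 6] *
          ((((k : GL (Fin 3) F))⁻¹ : GL (Fin 3) F) : Matrix (Fin 3) (Fin 3) F)) ∂(Measure.pi fun _ : Fin 7 => dx) ∂κ =
        ∫⁻ X, ((w X : ℝ≥0) : ℝ≥0∞) * g X ∂μ𝔤 := by
    intro g hg
    rw [hId g hg]
    refine lintegral_congr fun X => ?_
    rw [hwE X, mul_comm]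
  -- (2) the measure identity `Φ_*(κ ⊗ dx⁷) = w · μ𝔤`
  set Φ : ↥(glInt 3 F) × (Fin 7 → F) → Matrix (Fin 3) (Fin 3) F := fun p =>
    ((p.1 : GL (Fin 3) F) : Matrix (Fin 3) (Fin 3) F) * !![p.2 0, p.2 1, p.2 2; p.2 3, p.2 4, p.2 5; 0, 0, p.2 6] *
      ((((p.1 : GL (Fin 3) F))⁻¹ : GL (Fin 3) F) : Matrix (Fin 3) (Fin 3) F) with hΦ
  have hΦc : Continuous Φ := by
    refine (((Units.continuous_val.comp (continuous_subtype_val.comp continuous_fst))).mul ?_).mul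
      (Units.continuous_coe_inv.comp (continuous_subtype_val.comp continuous_fst))
    exact K2E3GL3ParabolicLieAdInvariant.continuous_parabolic.comp continuous_snd
  have hΦm : Measurable Φ := hΦc.measurable
  have hmeas : (κ.prod (Measure.pi fun _ : Fin 7 => dx)).map Φ = μ𝔤.withDensity fun X => ((w X : ℝ≥0) : ℝ≥0∞) := by
    ext A hA
    rw [Measure.map_apply hΦm hA, withDensity_apply _ hA, ← lintegral_indicator_one (hA.preimage hΦm),
      lintegral_prod _ ((measurable_one.indicator (hA.preimage hΦm)).aemeasurable)]
    have hind : ∀ p : ↥(glInt 3 F) × (Fin 7 → F), (Φ ⁻¹' A).indicator (1 : ↥(glInt 3 F) × (Fin 7 → F) → ℝ≥0∞) p = A.indicator 1 (Φ p) := by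
      intro p; simp only [Set.indicator_apply, mem_preimage, Pi.one_apply]
    simp_rw [hind]
    rw [hL (A.indicator 1) (measurable_one.indicator hA), ← lintegral_indicator hA]
    refine lintegral_congr fun X => ?_
    by_cases hX : X ∈ A
    · rw [indicator_of_mem hX, indicator_of_mem hX, Pi.one_apply, mul_one]
    · rw [indicator_of_notMem hX, indicator_of_notMem hX, mul_zero]
  -- (3) local finiteness ⇒ `W ∈ L¹_loc`
  have hWli : LocallyIntegrable W μ𝔤 := by
    refine (locallyIntegrable_iff).2 fun S hS => ?_
    refine ⟨hWm.aestronglyMeasurable, ?_⟩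
    show ∫⁻ X in S, ‖W X‖ₑ ∂μ𝔤 < ∞
    have h1 : ∫⁻ X in S, ‖W X‖ₑ ∂μ𝔤 = ∫⁻ X, ((w X : ℝ≥0) : ℝ≥0∞) * S.indicator 1 X ∂μ𝔤 := by
      rw [← lintegral_indicator hS.measurableSet]
      refine lintegral_congr fun X => ?_
      by_cases hX : X ∈ S
      · rw [indicator_of_mem hX, indicator_of_mem hX, Pi.one_apply, mul_one, ← ofReal_norm, hnormW, ENNReal.ofReal_coe_nnreal]
      · rw [indicator_of_notMem hX, indicator_of_notMem hX, mul_zero]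
    rw [h1, ← hL (S.indicator 1) (measurable_one.indicator hS.measurableSet)]
    -- the box: `Ad(K)⁻¹ S` is compact, so its `𝔭`-coordinates are bounded
    have hSK : IsCompact ((fun p : ↥(glInt 3 F) × Matrix (Fin 3) (Fin 3) F =>
        ((((p.1 : GL (Fin 3) F))⁻¹ : GL (Fin 3) F) : Matrix (Fin 3) (Fin 3) F) * p.2 * ((p.1 : GL (Fin 3) F) : Matrix (Fin 3) (Fin 3) F)) '' (univ ×ˢ S)) :=
      (isCompact_univ.prod hS).image ((((Units.continuous_coe_inv.comp (continuous_subtype_val.comp continuous_fst))).mul continuous_snd).mul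
        (Units.continuous_val.comp (continuous_subtype_val.comp continuous_fst)))
    obtain ⟨n, hn⟩ := K2E3GL3BorelSliceDensity.exists_forall_mem_primePowBall_of_isCompact hSK
    set R : Set (Fin 7 → F) := Set.pi univ fun _ => (primePowBall F (-(n : ℤ)) : Set F) with hR
    have hR_m : MeasurableSet R := MeasurableSet.univ_pi fun _ => measurableSet_primePowBall _
    have hsub : ∀ (k : ↥(glInt 3 F)) (r : Fin 7 → F), Φ (k, r) ∈ S → r ∈ R := by
      intro k r hkr
      have hb : (!![r 0, r 1, r 2; r 3, r 4, r 5; 0, 0, r 6] : Matrix (Fin 3) (Fin 3) F) ∈ (fun p : ↥(glInt 3 F) × Matrix (Fin 3) (Fin 3) F =>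
          ((((p.1 : GL (Fin 3) F))⁻¹ : GL (Fin 3) F) : Matrix (Fin 3) (Fin 3) F) * p.2 * ((p.1 : GL (Fin 3) F) : Matrix (Fin 3) (Fin 3) F)) '' (univ ×ˢ S) := by
        refine ⟨(k, Φ (k, r)), ⟨Set.mem_univ _, hkr⟩, ?_⟩
        simp only [hΦ]
        rw [show ((((k : GL (Fin 3) F))⁻¹ : GL (Fin 3) F) : Matrix (Fin 3) (Fin 3) F) * (((k : GL (Fin 3) F) : Matrix (Fin 3) (Fin 3) F) *
            !![r 0, r 1, r 2; r 3, r 4, r 5; 0, 0, r 6] * ((((k : GL (Fin 3) F))⁻¹ : GL (Fin 3) F) : Matrix (Fin 3) (Fin 3) F)) * ((k : GL (Fin 3) F) : Matrix (Fin 3) (Fin 3) F)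
            = (((((k : GL (Fin 3) F))⁻¹ : GL (Fin 3) F) : Matrix (Fin 3) (Fin 3) F) * ((k : GL (Fin 3) F) : Matrix (Fin 3) (Fin 3) F)) * !![r 0, r 1, r 2; r 3, r 4, r 5; 0, 0, r 6] *
            (((((k : GL (Fin 3) F))⁻¹ : GL (Fin 3) F) : Matrix (Fin 3) (Fin 3) F) * ((k : GL (Fin 3) F) : Matrix (Fin 3) (Fin 3) F)) by simp only [Matrix.mul_assoc],
          Units.inv_mul, Matrix.one_mul, Matrix.mul_one]
      have he := hn _ hb
      refine Set.mem_univ_pi.2 fun i => ?_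
      fin_cases i
      · exact he 0 0
      · exact he 0 1
      · exact he 0 2
      · exact he 1 0
      · exact he 1 1
      · exact he 1 2
      · exact he 2 2
    calc ∫⁻ k : ↥(glInt 3 F), ∫⁻ r : Fin 7 → F, S.indicator 1 (((k : GL (Fin 3) F) : Matrix (Fin 3) (Fin 3) F) * !![r 0, r 1, r 2; r 3, r 4, r 5; 0, 0, r 6] *
          ((((k : GL (Fin 3) F))⁻¹ : GL (Fin 3) F) : Matrix (Fin 3) (Fin 3) F)) ∂(Measure.pi fun _ : Fin 7 => dx) ∂κ
        ≤ ∫⁻ k : ↥(glInt 3 F), ∫⁻ r : Fin 7 → F, R.indicator 1 r ∂(Measure.pi fun _ : Fin 7 => dx) ∂κ := by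
          refine lintegral_mono fun k => lintegral_mono fun r => ?_
          by_cases hkr : Φ (k, r) ∈ S
          · rw [Set.indicator_of_mem (hsub k r hkr)]
            exact Set.indicator_le_self S 1 (Φ (k, r))
          · rw [Set.indicator_of_notMem (show Φ (k, r) ∉ S from hkr)]; exact zero_le
      _ = (Measure.pi fun _ : Fin 7 => dx) R * κ univ := by rw [lintegral_indicator_one hR_m, lintegral_const]
      _ < ∞ := by
          refine ENNReal.mul_lt_top ?_ (measure_lt_top κ _)
          rw [hR, Measure.pi_pi]
          exact ENNReal.prod_lt_top fun i _ => (isCompact_primePowBall (F := F) _).measure_lt_top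
  refine ⟨W, hWli, fun f hf => ?_, fun X hX => ?_, fun Cc hCc => ?_⟩
  · -- (4) the Bochner identity for `f ∈ C_c^∞`
    have hfm : Measurable f := hf.continuous.measurable
    have hint : Integrable (fun p : ↥(glInt 3 F) × (Fin 7 → F) => f (Φ p)) (κ.prod (Measure.pi fun _ : Fin 7 => dx)) := by
      refine ⟨(hf.continuous.comp hΦc).aestronglyMeasurable, ?_⟩
      show ∫⁻ p, ‖f (Φ p)‖ₑ ∂(κ.prod (Measure.pi fun _ : Fin 7 => dx)) < ∞
      rw [← lintegral_map (hfm.enorm) hΦm, hmeas, lintegral_withDensity_eq_lintegral_mul _ hwm.coe_nnreal_ennreal hfm.enorm]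
      obtain ⟨M, hM⟩ := hf.continuous.norm.bddAbove_range_of_hasCompactSupport hf.hasCompactSupport.norm
      have hK := (hWli.integrableOn_isCompact hf.hasCompactSupport).2
      calc ∫⁻ X, (fun X => ((w X : ℝ≥0) : ℝ≥0∞)) X * ‖f X‖ₑ ∂μ𝔤
          = ∫⁻ X in tsupport f, ((w X : ℝ≥0) : ℝ≥0∞) * ‖f X‖ₑ ∂μ𝔤 := by
            rw [← lintegral_indicator (isClosed_tsupport f).measurableSet]
            refine lintegral_congr fun X => ?_
            by_cases hX : X ∈ tsupport f
            · rw [indicator_of_mem hX]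
            · rw [indicator_of_notMem hX, image_eq_zero_of_notMem_tsupport hX, enorm_zero, mul_zero]
        _ ≤ ∫⁻ X in tsupport f, ‖W X‖ₑ * ENNReal.ofReal M ∂μ𝔤 := by
            refine lintegral_mono fun X => ?_
            have h1 : (((w X : ℝ≥0) : ℝ≥0∞)) = ‖W X‖ₑ := by
              rw [← ofReal_norm, hnormW, ENNReal.ofReal_coe_nnreal]
            rw [h1]
            exact mul_le_mul' le_rfl (by rw [← ofReal_norm]; exact ENNReal.ofReal_le_ofReal (hM ⟨X, rfl⟩))
        _ = (∫⁻ X in tsupport f, ‖W X‖ₑ ∂μ𝔤) * ENNReal.ofReal M := lintegral_mul_const _ hWm.enorm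
        _ < ∞ := ENNReal.mul_lt_top hK ENNReal.ofReal_lt_top
    calc ∫ k : ↥(glInt 3 F), ∫ r : Fin 7 → F,
          f (((k : GL (Fin 3) F) : Matrix (Fin 3) (Fin 3) F) * !![r 0, r 1, r 2; r 3, r 4, r 5; 0, 0, r 6] *
            ((((k : GL (Fin 3) F))⁻¹ : GL (Fin 3) F) : Matrix (Fin 3) (Fin 3) F)) ∂(Measure.pi fun _ : Fin 7 => dx) ∂κ
        = ∫ p, f (Φ p) ∂(κ.prod (Measure.pi fun _ : Fin 7 => dx)) := (integral_prod _ hint).symm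
      _ = ∫ X, f X ∂((κ.prod (Measure.pi fun _ : Fin 7 => dx)).map Φ) := (integral_map hΦm.aemeasurable hf.continuous.aestronglyMeasurable).symm
      _ = ∫ X, (w X) • f X ∂μ𝔤 := by rw [hmeas, integral_withDensity_eq_integral_smul hwm]
      _ = ∫ X, f X * W X ∂μ𝔤 := by
            refine integral_congr_ae (Filter.Eventually.of_forall fun X => ?_)
            show (w X) • f X = f X * W X
            simp only [hW, NNReal.smul_def, Complex.real_smul, mul_comm]
  · -- (5) local constancy on `{disc χ ≠ 0}` (★ H″6b: the set of roots moves continuously and `‖χ′‖` is locally constant along it)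
    have hX0 : X.charpoly.discr ≠ 0 := hX.ne_zero
    filter_upwards [K2E3GL3ParabolicSliceDensityLocal.setOf_discr_ne_zero_and_sum_eq_mem_nhds X hX0] with Y hY
    have hsY : s Y = s X := ENNReal.coe_injective (by rw [hscoe, hscoe]; exact hY.2)
    rw [hW]
    dsimp only
    rw [hw, Set.indicator_of_mem (show Y ∈ {X : Matrix (Fin 3) (Fin 3) F | X.charpoly.discr ≠ 0} from hY.1),
      Set.indicator_of_mem (show X ∈ {X : Matrix (Fin 3) (Fin 3) F | X.charpoly.discr ≠ 0} from hX0), hsY]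
  · -- (6) the bound `√‖disc‖ · ‖W‖ ≤ c · 3B` on the compact set `Cc` (★ W-BOUND, at most three roots)
    obtain ⟨B₀, hB₀⟩ := K2E3CubicDiscDerivativeBound.exists_bound_sqrt_discr_le_mul_derivative Cc hCc
    refine ⟨((c * (3 * B₀) : ℝ≥0) : ℝ), fun X hXC => ?_⟩
    rw [hnormW, ← NNReal.coe_mul]
    refine NNReal.coe_le_coe.2 ?_
    by_cases hXU : X ∈ {X : Matrix (Fin 3) (Fin 3) F | X.charpoly.discr ≠ 0}
    · rw [hw, Set.indicator_of_mem hXU, mul_left_comm]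
      refine mul_le_mul_of_nonneg_left ?_ zero_le
      rw [hs]
      dsimp only
      rw [← Multiset.sum_map_mul_left]
      refine (Multiset.sum_le_card_nsmul _ B₀ fun x hx => ?_).trans ?_
      · obtain ⟨a, ha, rfl⟩ := Multiset.mem_map.1 hx
        by_cases h0 : normAbs F (X.charpoly.derivative.eval a) = 0
        · rw [h0, _root_.inv_zero, mul_zero]; exact zero_le
        · exact (mul_inv_le_iff₀ (pos_iff_ne_zero.2 h0)).2 (hB₀ X hXC a ha)
      · rw [Multiset.card_map, nsmul_eq_mul]
        have hcard : Multiset.card X.charpoly.roots ≤ 3 :=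
          (Polynomial.card_roots' _).trans (by rw [Matrix.charpoly_natDegree_eq_dim, Fintype.card_fin])
        exact mul_le_mul_of_nonneg_right (by exact_mod_cast hcard) zero_le
    · rw [hw, Set.indicator_of_notMem hXU, mul_zero]; exact zero_le

end Head

end Summit.HodgeConjecture.HodgeConjecture.Cruxes.H413.K2E3GL3ParabolicSliceDensity

end
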